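import Summits.NavierStokesRegularity.TurbBounds.Results.P2R3
import Summits.NavierStokesRegularity.TurbBounds.P2R4Profile
import HarnessLib

/-!
(gen 7, 2026-08-22, dedup fixes per pub-turb-sos DEDUP-PREFLIGHT / lead decision 104: `legendre_two…five_eval` are used from `P2R4Profile` by name instead of being restated; `gp_abs_le` moved here from `Results/P2R3Tail.lean`.)
# Row P2-R3: the coupling profile `g = −(sκ/2)·η′₅((x+1)/2)` IS `Σ_{p≤5} ĝ_p P_p` with the tree's literal `ĝ_p` (LEAN-MAP data item (b))
(cell `pub-turb` / `turb-bounds`; v2 groundwork for the P2-R3 tail lemma: the profile enters `TailPolyGen.layerForm_poly_lower_bound` as a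
polynomial `gp` of degree `≤ 5` with `gOf s κ η′ = gp.eval`; here `gp` is written in the Legendre basis with the literal data
`Certs.P2R3.Evaluator.ghat0 … ghat5` of `EvalShared.lean`, so that `ĉ_p(gp) = ĝ_p` is immediate. Kernel arithmetic only.)

HONEST FRAMING: rigorous bounds for the stated PDE and boundary conditions; no claim about physical turbulence beyond the bound.
-/

set_option linter.style.longLine false

noncomputable section

namespace Summit.NavierStokesRegularity.TurbBounds.TailP2R3

open Polynomial Finset Literature.Analysis.SpecialFunctions
open Summit.NavierStokesRegularity.TurbBounds.LayerForm (gOf)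
open Summit.NavierStokesRegularity.TurbBounds.Certs.P2R3.Evaluator (ghat0 ghat1 ghat2 ghat3 ghat4 ghat5 T)
open Summit.NavierStokesRegularity.TurbBounds.TailP2R4 (legendre_two_eval legendre_three_eval legendre_four_eval legendre_five_eval)   -- proved once, in P2R4Profile (lands first); gen 7 dedup fix

/-- The literal Legendre data of the profile as a real sequence `ĝ_0 … ĝ_5` (zero beyond). -/
def ghatR : ℕ → ℝ
  | 0 => ghat0 | 1 => ghat1 | 2 => ghat2 | 3 => ghat3 | 4 => ghat4 | 5 => ghat5 | _ => 0

/-- The profile polynomial of row P2-R3 in the Legendre basis: `gp = Σ_{p≤5} ĝ_p P_p`. -/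
def gp : ℝ[X] := ∑ p ∈ range (5 + 1), C (ghatR p) * legendre p

/-- `deg gp ≤ 5`. -/
theorem natDegree_gp_le : gp.natDegree ≤ 5 := by
  unfold gp
  refine natDegree_sum_le_of_forall_le _ _ (fun p hp => ?_)
  refine (natDegree_C_mul_le _ _).trans ?_
  rw [natDegree_legendre]
  rw [Finset.mem_range] at hp; omega

/-- **The literal `ĝ_p` ARE the Legendre data of the member's coupling profile**: `g(x) = −(3/2·171/2)·η′₅((x+1)/2) = Σ_{p≤5} ĝ_p P_p(x)`
for every real `x` (exact polynomial identity; LEAN-MAP data item (b) for row P2-R3, kernel-checked). -/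
theorem gp_eval (x : ℝ) : gp.eval x = gOf (3 / 2) 171 Results.P2R3.eta x := by
  unfold gp gOf Results.P2R3.eta
  simp only [sum_range_succ, sum_range_zero, zero_add, ghatR]
  simp only [eval_add, eval_mul, eval_C, eval_X, legendre_zero, legendre_one, eval_one, legendre_two_eval, legendre_three_eval,
    legendre_four_eval, legendre_five_eval, ghat0, ghat1, ghat2, ghat3, ghat4, ghat5]
  push_cast
  ring

/-- `|g| ≤ T` on `[-1, 1]` for the profile polynomial (the tree's `Results.P2R3.g_abs_le`, `T = 6680799/4000`). Stated here, in the file that defines `gp`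
(gen 7 dedup fix: its text coincides with P2R4's `gp_abs_le` after short-naming). -/
theorem gp_abs_le : ∀ x ∈ Set.Icc (-1 : ℝ) 1, |gp.eval x| ≤ ((T : ℚ) : ℝ) := by
  intro x hx
  rw [gp_eval x]
  have h := Results.P2R3.g_abs_le x hx
  have e : ((T : ℚ) : ℝ) = (6680799 : ℝ) / 4000 := by norm_num [T]
  rw [e]; exact h

end Summit.NavierStokesRegularity.TurbBounds.TailP2R3

end
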